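import Summits.AnomalousDissipation.AnomalousDissipation.Theorems.WindLineWindyGalerkinSteadyZerothLawGenericLeafNondegeneracyToolsH
import Summits.AnomalousDissipation.AnomalousDissipation.Theorems.WindLineWindyGalerkinSteadyZerothLawGenericLeafNondegeneracyToolsI

/-!
# Generic leaf-nondegeneracy (stub B of crux `WindLine.WindyGalerkinSteadyZerothLaw`,
# stmt-AnomalousDissipation-11414), tools L: finite-mode parameter slices of `𝒜` and the parametrised
# steady map

Helper layer (pure proof file, no definitions).  For a stage `N`, the **finite-mode slice**
`Γ_N = {γ ∈ SymL2 | γ 0 = 0, k·γ(k) = 0, γ(k) = 0 off freqBall N}` is a finite-dimensional real subspace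
of `SymL2 (Fin 3)` with `c₀ + Γ_N ⊆ 𝒜` for every admissible `c₀` (`exists_paramSlice`); the force
vectors along it are given by an injective continuous linear `F_N : Γ_N → W`, `Y(c₀ + γ) = Y c₀ + F_N γ`,
whose range is exactly the range of the Fourier truncation `P_N` on `W` (`exists_sliceMap`).  The
parametrised drifted steady map `Ψ(x, γ) = 4π²ν x + D x + B(x,x) − Y c₀ − F_N γ` is strictly
differentiable with derivative `Ψ'(x,γ)(ξ,η) = T(x) ξ − F_N η`, continuous in `(x, γ)`
(`hasStrictFDerivAt_param`, `continuous_paramDeriv`).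

References: Foias–Temam, LNM 565 (1976), p. 26 (finite-mode perturbations).
-/

noncomputable section

-- D-0017: single-problem summit ⇒ the duplicated namespace segment is by design.
set_option linter.dupNamespace false

open scoped BigOperators Topology ENNReal NNReal InnerProductSpace ComplexConjugate
open Filter Set Function TopologicalSpace MeasureTheory UnitAddTorus
open Literature.Analysis.FunctionSpaces Literature.Analysis.FunctionSpaces.Torus
open Literature.Analysis.FunctionSpaces.EuclideanSpace
open Literature.Analysis.FluidPDE Literature.Analysis.FluidPDE.Torus
open Literature.Analysis.FluidPDE.ScalarFourier
open Literature.Analysis.FluidPDE.SteadyLattice Literature.Analysis.FluidPDE.SteadyLatticeDrift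

namespace Summit.AnomalousDissipation.AnomalousDissipation.Theorems.WindLineWindyGalerkinSteadyZerothLaw.GenericLeaf

/-- The flat three-torus (local notation). -/
local notation "𝕋³" => UnitAddTorus (Fin 3)
/-- Velocity values (local notation). -/
local notation "E³" => EuclideanSpace ℝ (Fin 3)
/-- Complex coefficient vectors (local notation). -/
local notation "ℂ³" => EuclideanSpace ℂ (Fin 3)
/-- Square-summable coefficient families `ℤ³ → ℂ³` (local notation). -/
local notation "ℓ2" => lp (fun _ : Fin 3 → ℤ => EuclideanSpace ℂ (Fin 3)) 2
/-- Physical coefficients `x̌(k) = x(k)/|k|²` of a family (local notation, the tree's `cf`). -/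
local notation "cf[" X "]" =>
  ((fun mm : Fin 3 → ℤ => (((freqNormSq mm)⁻¹ : ℝ) : ℂ)) • (X : (Fin 3 → ℤ) → EuclideanSpace ℂ (Fin 3)))
/-- `k · v = ∑ⱼ kⱼ vⱼ` (local notation, the tree's `kdot`). -/
local notation "kdot[" k "," v "]" =>
  (∑ jj : Fin 3, (((k : Fin 3 → ℤ) jj : ℤ) : ℂ) * (v : EuclideanSpace ℂ (Fin 3)) jj)
/-- The convective symbol `N(a, b)(k)` as a vector of `ℂ³` (local notation, the tree's `nl`). -/
local notation "nl[" a "," b "," k "]" =>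
  ((WithLp.toLp 2 (fun pp : Fin 3 => transportSym (fun jj mm => (a : (Fin 3 → ℤ) → EuclideanSpace ℂ (Fin 3)) mm jj)
    (fun mm => (b : (Fin 3 → ℤ) → EuclideanSpace ℂ (Fin 3)) mm pp) k)) : EuclideanSpace ℂ (Fin 3))
set_option quotPrecheck false in
/-- admissible parameters -/
local notation "𝒜" => ({c : SymL2 (Fin 3) | c 0 = 0 ∧
  ∀ k : Fin 3 → ℤ, ∑ j : Fin 3, ((k j : ℤ) : ℂ) * c k j = 0} : Set (SymL2 (Fin 3)))
/-- the force of a parameter -/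
local notation "F⟦" c "⟧" => SymL2.field (fun k : Fin 3 → ℤ => Real.exp (freqNormSq k)) (c : SymL2 (Fin 3))

/-! ## §1 The finite-mode slice of the admissible parameters -/

/-- **The finite-mode slice `Γ_N`** exists as a real subspace of `SymL2 (Fin 3)`, is finite
dimensional, and translates admissible parameters into admissible parameters. [folklore] -/
theorem exists_paramSlice (N : ℕ) : ∃ Γs : Submodule ℝ (SymL2 (Fin 3)),
    (∀ γ : SymL2 (Fin 3), γ ∈ Γs ↔ (γ 0 = 0 ∧ (∀ k : Fin 3 → ℤ, kdot[k, γ k] = 0) ∧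
      ∀ k : Fin 3 → ℤ, k ∉ freqBall N → γ k = 0)) ∧
    FiniteDimensional ℝ Γs ∧
    ∀ (c₀ : 𝒜) (γ : SymL2 (Fin 3)), γ ∈ Γs → (c₀ : SymL2 (Fin 3)) + γ ∈ 𝒜 := by
  set Γs : Submodule ℝ (SymL2 (Fin 3)) :=
    { carrier := {γ | γ 0 = 0 ∧ (∀ k : Fin 3 → ℤ, kdot[k, γ k] = 0) ∧ ∀ k : Fin 3 → ℤ, k ∉ freqBall N → γ k = 0}
      add_mem' := by
        rintro a b ⟨ha0, hat, has⟩ ⟨hb0, hbt, hbs⟩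
        refine ⟨by rw [SymL2.add_apply, ha0, hb0, add_zero], fun k => ?_, fun k hk => ?_⟩
        · rw [SymL2.add_apply, kdot_add, hat, hbt, add_zero]
        · rw [SymL2.add_apply, has k hk, hbs k hk, add_zero]
      zero_mem' := ⟨rfl, fun k => by simp, fun k _ => rfl⟩
      smul_mem' := by
        rintro r a ⟨ha0, hat, has⟩
        refine ⟨by rw [SymL2.smul_apply, ha0, smul_zero], fun k => ?_, fun k hk => ?_⟩
        · rw [SymL2.smul_apply, kdot_smul, hat, mul_zero]
        · rw [SymL2.smul_apply, has k hk, smul_zero] } with hΓs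
  refine ⟨Γs, fun γ => Iff.rfl, ?_, fun c₀ γ hγ => ?_⟩
  · -- finite dimension: inject into the functions on the frequency ball
    set L : Γs →ₗ[ℝ] ({k : Fin 3 → ℤ // k ∈ freqBall N} → ℂ³) :=
      { toFun := fun γ k => (γ : SymL2 (Fin 3)) k.1
        map_add' := fun a b => funext fun k => by simp
        map_smul' := fun r a => funext fun k => by
          simp only [RingHom.id_apply, Pi.smul_apply]
          exact (Complex.coe_smul r _).symm } with hL
    refine FiniteDimensional.of_injective L fun a b hab => ?_
    refine Subtype.ext (SymL2.ext fun k => ?_)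
    by_cases hk : k ∈ freqBall N
    · exact congrFun hab ⟨k, hk⟩
    · rw [a.2.2.2 k hk, b.2.2.2 k hk]
  · obtain ⟨h0, htr⟩ := c₀.2
    obtain ⟨hγ0, hγt, -⟩ := hγ
    refine ⟨by rw [SymL2.add_apply, h0, hγ0, add_zero], fun k => ?_⟩
    change kdot[k, ((c₀ : SymL2 (Fin 3)) + γ) k] = 0
    rw [SymL2.add_apply, kdot_add, htr k, hγt k, add_zero]

section Slice

variable {W : Submodule ℝ ℓ2}
variable (hW : ∀ x : ℓ2, x ∈ W ↔ (((x : ℓ2) : (Fin 3 → ℤ) → ℂ³) 0 = 0 ∧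
  (∀ kk : Fin 3 → ℤ, kdot[kk, ((x : ℓ2) : (Fin 3 → ℤ) → ℂ³) kk] = 0) ∧ IsConjSymm ((x : ℓ2) : (Fin 3 → ℤ) → ℂ³)))
variable (P : ℕ → W →L[ℝ] W)
variable (hP : ∀ (N : ℕ) (x : W) (k : Fin 3 → ℤ),
  (((P N x : W) : ℓ2) : (Fin 3 → ℤ) → ℂ³) k = if k ∈ freqBall N then ((x : ℓ2) : (Fin 3 → ℤ) → ℂ³) k else 0)
variable (Y : 𝒜 → W)
variable (hY : ∀ (c : 𝒜) (k : Fin 3 → ℤ), (((Y c : W) : ℓ2) : (Fin 3 → ℤ) → ℂ³) k = mFourierCoeff (complexify ∘ F⟦c⟧) k)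

include hW hP hY in
/-- **The slice map `F_N : Γ_N → W`**: continuous linear, injective, with coordinates the force
coefficients `e^{-|k|²} γ k`, `Y(c₀ + γ) = Y c₀ + F_N γ`, and `range F_N = range P_N`. [folklore] -/
theorem exists_sliceMap (N : ℕ) (Γs : Submodule ℝ (SymL2 (Fin 3)))
    (hΓs : ∀ γ : SymL2 (Fin 3), γ ∈ Γs ↔ (γ 0 = 0 ∧ (∀ k : Fin 3 → ℤ, kdot[k, γ k] = 0) ∧
      ∀ k : Fin 3 → ℤ, k ∉ freqBall N → γ k = 0)) [FiniteDimensional ℝ Γs]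
    (hadm : ∀ (c₀ : 𝒜) (γ : SymL2 (Fin 3)), γ ∈ Γs → (c₀ : SymL2 (Fin 3)) + γ ∈ 𝒜) :
    ∃ F : Γs →L[ℝ] W,
      (∀ (γ : Γs) (k : Fin 3 → ℤ), (((F γ : W) : ℓ2) : (Fin 3 → ℤ) → ℂ³) k =
        SymL2.coef (fun k : Fin 3 → ℤ => Real.exp (freqNormSq k)) (γ : SymL2 (Fin 3)) k) ∧
      Function.Injective F ∧
      (∀ (c₀ : 𝒜) (γ : Γs), Y ⟨(c₀ : SymL2 (Fin 3)) + γ, hadm c₀ γ γ.2⟩ = Y c₀ + F γ) ∧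
      LinearMap.range (F : Γs →ₗ[ℝ] W) = LinearMap.range ((P N : W →L[ℝ] W) : W →ₗ[ℝ] W) := by
  set w : (Fin 3 → ℤ) → ℝ := fun k => Real.exp (freqNormSq k) with hw
  -- the `W`-element of a slice parameter
  have hmem : ∀ γ : SymL2 (Fin 3), Memℓp (SymL2.coef w γ) 2 := fun γ =>
    memℓp_two_of_tsum_ne_top (ne_top_of_le_ne_top (ENNReal.pow_ne_top enorm_ne_top) (tsum_enorm_sq_coef_le γ))
  have hV : ∀ γ : Γs, ((SymL2.coef w γ : (Fin 3 → ℤ) → ℂ³) 0 = 0 ∧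
      (∀ kk : Fin 3 → ℤ, kdot[kk, (SymL2.coef w γ : (Fin 3 → ℤ) → ℂ³) kk] = 0) ∧
      IsConjSymm (SymL2.coef w γ : (Fin 3 → ℤ) → ℂ³)) := by
    intro γ
    obtain ⟨h0, htr, -⟩ := (hΓs γ).1 γ.2
    refine ⟨by rw [SymL2.coef_apply, h0, smul_zero], fun k => ?_, SymL2.isConjSymm_coef forceDict_isWeight _⟩
    rw [SymL2.coef_apply, kdot_smul, htr k, mul_zero]
  set F₀ : Γs →ₗ[ℝ] W :=
    { toFun := fun γ => ⟨⟨SymL2.coef w γ, hmem γ⟩, (hW _).2 (hV γ)⟩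
      map_add' := fun a b => Subtype.ext (lp.ext (funext fun k => by
        change SymL2.coef w ((a : SymL2 (Fin 3)) + b) k = SymL2.coef w (a : SymL2 (Fin 3)) k + SymL2.coef w (b : SymL2 (Fin 3)) k
        exact SymL2.coef_add _ _ k))
      map_smul' := fun r a => Subtype.ext (lp.ext (funext fun k => by
        change SymL2.coef w (r • (a : SymL2 (Fin 3))) k = ((r : ℂ)) • SymL2.coef w (a : SymL2 (Fin 3)) k
        rw [SymL2.coef_smul])) } with hF₀
  set F : Γs →L[ℝ] W := LinearMap.toContinuousLinearMap F₀ with hF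
  have hFc : ∀ (γ : Γs) (k : Fin 3 → ℤ), (((F γ : W) : ℓ2) : (Fin 3 → ℤ) → ℂ³) k = SymL2.coef w (γ : SymL2 (Fin 3)) k :=
    fun γ k => rfl
  have hwk : ∀ k, (w k : ℂ) ≠ 0 := fun k => by
    rw [hw]; exact_mod_cast (Real.exp_pos _).ne'
  refine ⟨F, hFc, ?_, ?_, ?_⟩
  · -- injective
    intro a b hab
    refine Subtype.ext (SymL2.ext fun k => ?_)
    have h := congrArg (fun z : W => (((z : W) : ℓ2) : (Fin 3 → ℤ) → ℂ³) k) hab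
    simp only [hFc, SymL2.coef_apply] at h
    exact smul_right_injective _ (inv_ne_zero (hwk k)) h
  · -- additivity of the force vectors along the slice
    intro c₀ γ
    refine Subtype.ext (lp.ext (funext fun k => ?_))
    rw [coeW_add, Pi.add_apply, hY, hY, hFc, mFourierCoeff_force, mFourierCoeff_force]
    exact SymL2.coef_add _ _ k
  · -- the range is the range of the truncation
    refine le_antisymm ?_ ?_
    · rintro _ ⟨γ, rfl⟩
      obtain ⟨-, -, hsupp⟩ := (hΓs γ).1 γ.2
      refine ⟨F γ, Subtype.ext (lp.ext (funext fun k => ?_))⟩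
      change (((P N (F γ) : W) : ℓ2) : (Fin 3 → ℤ) → ℂ³) k = (((F γ : W) : ℓ2) : (Fin 3 → ℤ) → ℂ³) k
      rw [hP]
      by_cases hk : k ∈ freqBall N
      · rw [if_pos hk]
      · rw [if_neg hk, hFc, SymL2.coef_apply, hsupp k hk, smul_zero]
    · -- every element of `W` supported in the ball is a slice force vector
      have hsub : ∀ y : W, (∀ k, k ∉ freqBall N → (((y : W) : ℓ2) : (Fin 3 → ℤ) → ℂ³) k = 0) →
          y ∈ LinearMap.range (F : Γs →ₗ[ℝ] W) := by
        intro y hy0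
        -- the slice parameter `γ(k) = e^{|k|²} y(k)`
        obtain ⟨g, hg⟩ : ∃ g : (Fin 3 → ℤ) → ℂ³, g = fun k => (w k : ℂ) • (((y : W) : ℓ2) : (Fin 3 → ℤ) → ℂ³) k :=
          ⟨_, rfl⟩
        have hgS : ∀ k ∉ freqBall N, g k = 0 := fun k hk => by rw [hg]; dsimp only; rw [hy0 k hk, smul_zero]
        have hgc : IsConjSymm g := fun k => by
          rw [hg]; dsimp only
          rw [W_conj hW y k, conjVec_smul, Complex.conj_ofReal, hw]
          dsimp only
          rw [freqNormSq_neg]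
        obtain ⟨γ, hγ⟩ : ∃ γ : SymL2 (Fin 3), γ = SymL2.ofFinSupp g (freqBall N) hgS hgc := ⟨_, rfl⟩
        have hγk : ∀ k, γ k = g k := fun k => by rw [hγ]; exact SymL2.ofFinSupp_apply g _ hgS hgc k
        have hγmem : γ ∈ Γs := by
          refine (hΓs γ).2 ⟨?_, fun k => ?_, fun k hk => ?_⟩
          · rw [hγk, hg]; dsimp only; rw [W_zero hW y, smul_zero]
          · rw [hγk, hg]; dsimp only; rw [kdot_smul, W_trans hW y k, mul_zero]
          · rw [hγk, hgS k hk]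
        refine ⟨⟨γ, hγmem⟩, Subtype.ext (lp.ext (funext fun k => ?_))⟩
        change (((F ⟨γ, hγmem⟩ : W) : ℓ2) : (Fin 3 → ℤ) → ℂ³) k = (((y : W) : ℓ2) : (Fin 3 → ℤ) → ℂ³) k
        rw [hFc, SymL2.coef_apply]
        change ((w k : ℂ))⁻¹ • γ k = _
        rw [hγk, hg]
        dsimp only
        rw [smul_smul, inv_mul_cancel₀ (hwk k), one_smul]
      rintro _ ⟨z, rfl⟩
      exact hsub (P N z) fun k hk => by rw [hP, if_neg hk]

end Slice

/-! ## §2 The parametrised steady map and its derivative -/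

section Param

variable {E Γ : Type*} [NormedAddCommGroup E] [NormedSpace ℝ E] [NormedAddCommGroup Γ] [NormedSpace ℝ Γ]
variable (B : E → E → E) (hBb : IsBoundedBilinearMap ℝ (fun p : E × E => B p.1 p.2)) (D : E →L[ℝ] E)
  (F : Γ →L[ℝ] E) (y₀ : E) (c : ℝ)

/-- The parametrised linearisation applied: `Ψ'(x,γ)(ξ,η) = T(x) ξ − F η`. [folklore] -/
theorem paramDeriv_apply (z ζ : E × Γ) :
    ((c • ContinuousLinearMap.id ℝ E +
        (D + (hBb.deriv (z.1, z.1)).comp ((ContinuousLinearMap.id ℝ E).prod (ContinuousLinearMap.id ℝ E)))).comp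
          (ContinuousLinearMap.fst ℝ E Γ) - F.comp (ContinuousLinearMap.snd ℝ E Γ)) ζ =
      (c • ContinuousLinearMap.id ℝ E +
        (D + (hBb.deriv (z.1, z.1)).comp ((ContinuousLinearMap.id ℝ E).prod (ContinuousLinearMap.id ℝ E)))) ζ.1 - F ζ.2 :=
  rfl

/-- **The parametrised steady map is strictly differentiable** everywhere, with derivative
`(ξ, η) ↦ T(x) ξ − F η`, `T(x) = c + (D + K_x)`. [folklore] -/
theorem hasStrictFDerivAt_param (z : E × Γ) :
    HasStrictFDerivAt (fun z : E × Γ => c • z.1 + D z.1 + B z.1 z.1 - y₀ - F z.2)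
      ((c • ContinuousLinearMap.id ℝ E +
        (D + (hBb.deriv (z.1, z.1)).comp ((ContinuousLinearMap.id ℝ E).prod (ContinuousLinearMap.id ℝ E)))).comp
          (ContinuousLinearMap.fst ℝ E Γ) - F.comp (ContinuousLinearMap.snd ℝ E Γ)) z := by
  have h1 : HasStrictFDerivAt (fun x : E => c • x + B x x)
      (c • ContinuousLinearMap.id ℝ E +
        (hBb.deriv (z.1, z.1)).comp ((ContinuousLinearMap.id ℝ E).prod (ContinuousLinearMap.id ℝ E))) z.1 :=
    hasStrictFDerivAt_steadyMap hBb c z.1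
  have h2 : HasStrictFDerivAt (fun z : E × Γ => c • z.1 + B z.1 z.1)
      ((c • ContinuousLinearMap.id ℝ E +
        (hBb.deriv (z.1, z.1)).comp ((ContinuousLinearMap.id ℝ E).prod (ContinuousLinearMap.id ℝ E))).comp
          (ContinuousLinearMap.fst ℝ E Γ)) z :=
    h1.comp z hasStrictFDerivAt_fst
  have h3 : HasStrictFDerivAt (fun z : E × Γ => D z.1) (D.comp (ContinuousLinearMap.fst ℝ E Γ)) z :=
    D.hasStrictFDerivAt.comp z hasStrictFDerivAt_fst
  have h4 : HasStrictFDerivAt (fun z : E × Γ => F z.2) (F.comp (ContinuousLinearMap.snd ℝ E Γ)) z :=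
    F.hasStrictFDerivAt.comp z hasStrictFDerivAt_snd
  have h := ((h2.add h3).sub_const y₀).sub h4
  have e : ((fun x => ((fun z : E × Γ => c • z.1 + B z.1 z.1) + fun z : E × Γ => D z.1) x - y₀) - fun z : E × Γ => F z.2) =
      fun z : E × Γ => c • z.1 + D z.1 + B z.1 z.1 - y₀ - F z.2 := by
    funext z
    simp only [Pi.sub_apply, Pi.add_apply]
    abel
  rw [e] at h
  refine h.congr_fderiv (ContinuousLinearMap.ext fun ζ => ?_)
  simp only [sub_apply, add_apply, ContinuousLinearMap.comp_apply, smul_apply, ContinuousLinearMap.id_apply,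
    ContinuousLinearMap.coe_fst', ContinuousLinearMap.coe_snd']
  abel

/-- **The parametrised linearisation depends continuously on the point.** [folklore] -/
theorem continuous_paramDeriv :
    Continuous fun z : E × Γ => ((c • ContinuousLinearMap.id ℝ E +
        (D + (hBb.deriv (z.1, z.1)).comp ((ContinuousLinearMap.id ℝ E).prod (ContinuousLinearMap.id ℝ E)))).comp
          (ContinuousLinearMap.fst ℝ E Γ) - F.comp (ContinuousLinearMap.snd ℝ E Γ)) := by
  have h1 : Continuous fun z : E × Γ => c • ContinuousLinearMap.id ℝ E +
      (D + (hBb.deriv (z.1, z.1)).comp ((ContinuousLinearMap.id ℝ E).prod (ContinuousLinearMap.id ℝ E))) :=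
    (continuous_linearisation B hBb D c).comp continuous_fst
  refine Continuous.sub ?_ continuous_const
  exact (isBoundedBilinearMap_comp (𝕜 := ℝ) (E := E × Γ) (F := E) (G := E)).continuous.comp
    (h1.prodMk continuous_const)

end Param

/-! ## §3 Registered sub-goal -/

/-- **Registered sub-goal `genericLeaf_toolsL`** (worker B of stub `stub_genericLeafNondegeneracy`): the
finite-mode slices of the admissible parameters, `exists_paramSlice` in Pi-form. [folklore] -/
theorem genericLeaf_toolsL : ∀ N : ℕ, ∃ Γs : Submodule ℝ (SymL2 (Fin 3)), (∀ γ : SymL2 (Fin 3), γ ∈ Γs ↔ (γ 0 = 0 ∧ (∀ k : Fin 3 → ℤ, kdot[k, γ k] = 0) ∧ ∀ k : Fin 3 → ℤ, k ∉ freqBall N → γ k = 0)) ∧ FiniteDimensional ℝ Γs ∧ ∀ (c₀ : 𝒜) (γ : SymL2 (Fin 3)), γ ∈ Γs → (c₀ : SymL2 (Fin 3)) + γ ∈ 𝒜 :=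
  exists_paramSlice

end Summit.AnomalousDissipation.AnomalousDissipation.Theorems.WindLineWindyGalerkinSteadyZerothLaw.GenericLeaf

end
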